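import Summits.AtomisticToContinuum.FouriersLaw.Theses.PhononMeanFreePath

/-!
# Route `PhononMeanFreePath` — posited objects (vocabulary of the crux lines of `IncoherentChannel`)

Definitions file of route `PhononMeanFreePath` (sub-problem `FouriersLaw`, summit `AtomisticToContinuum`),
opened by the line lead of crux `IncoherentChannel` (stmt-AtomisticToContinuum-11811, line
`two-horizons-forecast-loss`). It fixes, once, the kernel-level vocabulary in which the line's stubs are
registered on the ledger and landed (`Theorems/PhononMeanFreePathIncoherentChannel*.lean`), so that the stub
files state their registered signatures over shared names instead of carrying private copies.

Fix `ω₂ lam β γ T : ℝ`, `P = pinnedChain ω₂ lam β γ`, the `(N+1)`-site chain `0..N` with BOTH Langevin baths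
at temperature `T`; `μ₀ = P.gibbsMeasure (N+1) T` (Gibbs law, `LangevinChainGibbs`) and
`K_t = P.transitionKernel (N+1) T T t` (the CONSTRUCTED transition kernels, `LangevinChainKernel`), real time
clamped at `0⁺` by `Real.toNNReal` exactly as in the route file. All objects are Gibbs-averaged Bochner
integrals:

* `fcast … N t z = (K_t p_N)(z)` — the mean forecast of the far momentum from the exact microstate `z`;
* `fnorm … N t = ‖K_t p_N‖²_{L²(μ₀)}` — the forecast norm `S_N(t)`;
* `pairCorr … N t = ⟨p_0, K_t p_N⟩_{μ₀}` — the route's end-to-end pair correlation `r_N(t)`;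
* `commonPast … N t = Cov_{μ₀}(p_0², (K_t p_N)²)` — the common-past part `P_N(t)`;
* `powerCov … N t = Cov_{μ₀}(p_0², K_t p_N²)` — VERBATIM the crux's kernel `C_N(t)`;
* `varianceChannel … N t = C_N(t) − P_N(t) = Cov_{μ₀}(p_0², Var(p_N(t) | z))` — the conditional-variance
  channel `B_N(t)`.

Everything is an explicit abbreviation of tree objects (`OscillatorChain.transitionKernel`,
`OscillatorChain.gibbsMeasure` of `pinnedChain`); nothing carries axioms; no statement of the route is
restated. The elementary facts recorded next to the vocabulary: `fnorm_nonneg`, and the algebraic identity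
`powerCov − 2·pairCorr² = varianceChannel + (commonPast − 2·pairCorr²)` (`cumulant_split`, the law of total
variance at the level of closed terms, `ring`), plus `cruxIntegrand_eq` identifying `powerCov − 2·pairCorr²`
with the crux's integrand as printed in `PhononMeanFreePath.IncoherentChannel`.
-/

noncomputable section

namespace Summit.AtomisticToContinuum.FouriersLaw.Theorems.PhononMeanFreePath

open MeasureTheory
open scoped NNReal
open Literature.MathematicalPhysics.KineticTheory.HeatConduction

variable (ω₂ lam β γ T : ℝ)

/-- MEAN FORECAST of the far momentum, `v_t(z) = (K_t p_N)(z) = E_z[p_N(t)]` for the `(N+1)`-site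
pinned chain with both baths at `T` (randomness = the two bath noises only; real time clamped at `0⁺`
exactly as in the route file `PhononMeanFreePath`). -/
def fcast (N : ℕ) (t : ℝ) (z : PhaseSpace (N + 1)) : ℝ :=
  ∫ y, y.2 (Fin.last N) ∂((pinnedChain ω₂ lam β γ).transitionKernel (N + 1) T T t.toNNReal z)

/-- FORECAST NORM `S_N(t) = ‖K_t p_N‖²_{L²(μ₀)}` (equivalently `E[p_N^{(1)}(t) p_N^{(2)}(t)]` for two noise
replicas forked from one Gibbs microstate). -/
def fnorm (N : ℕ) (t : ℝ) : ℝ :=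
  ∫ z, (fcast ω₂ lam β γ T N t z) ^ 2 ∂((pinnedChain ω₂ lam β γ).gibbsMeasure (N + 1) T)

/-- END-TO-END PAIR CORRELATION `r_N(t) = ⟨p_0, K_t p_N⟩_{μ₀}` (the route's `r_N`, verbatim once `fcast`
is unfolded). -/
def pairCorr (N : ℕ) (t : ℝ) : ℝ :=
  ∫ z, z.2 0 * fcast ω₂ lam β γ T N t z ∂((pinnedChain ω₂ lam β γ).gibbsMeasure (N + 1) T)

/-- COMMON-PAST PART `P_N(t) = Cov_{μ₀}(p_0², v_t²)` — the part of the power covariance routed through the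
MEAN forecast (it contains the Wick term `2 r_N²` and the common-past fluctuation `P_N − 2 r_N²`). -/
def commonPast (N : ℕ) (t : ℝ) : ℝ :=
  (∫ z, (z.2 0) ^ 2 * (fcast ω₂ lam β γ T N t z) ^ 2 ∂((pinnedChain ω₂ lam β γ).gibbsMeasure (N + 1) T)) -
    (∫ z, (z.2 0) ^ 2 ∂((pinnedChain ω₂ lam β γ).gibbsMeasure (N + 1) T)) *
      (∫ z, (fcast ω₂ lam β γ T N t z) ^ 2 ∂((pinnedChain ω₂ lam β γ).gibbsMeasure (N + 1) T))

/-- POWER COVARIANCE `C_N(t) = Cov_{μ₀}(p_0², K_t p_N²)` — VERBATIM the kernel of the crux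
`PhononMeanFreePath.IncoherentChannel` (and of `BoundaryKubo`). -/
def powerCov (N : ℕ) (t : ℝ) : ℝ :=
  (∫ z, (z.2 0) ^ 2 * (∫ y, (y.2 (Fin.last N)) ^ 2
      ∂((pinnedChain ω₂ lam β γ).transitionKernel (N + 1) T T t.toNNReal z))
      ∂((pinnedChain ω₂ lam β γ).gibbsMeasure (N + 1) T)) -
    (∫ z, (z.2 0) ^ 2 ∂((pinnedChain ω₂ lam β γ).gibbsMeasure (N + 1) T)) *
      (∫ z, (∫ y, (y.2 (Fin.last N)) ^ 2
        ∂((pinnedChain ω₂ lam β γ).transitionKernel (N + 1) T T t.toNNReal z))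
        ∂((pinnedChain ω₂ lam β γ).gibbsMeasure (N + 1) T))

/-- VARIANCE CHANNEL `B_N(t) = C_N(t) − P_N(t) = Cov_{μ₀}(p_0², Var(p_N(t) | z))` — the covariance of the
initial left kinetic energy with the forecast VARIANCE of the far momentum. -/
def varianceChannel (N : ℕ) (t : ℝ) : ℝ :=
  powerCov ω₂ lam β γ T N t - commonPast ω₂ lam β γ T N t

/-- The forecast norm is non-negative (integral of a square). -/
theorem fnorm_nonneg (N : ℕ) (t : ℝ) : 0 ≤ fnorm ω₂ lam β γ T N t :=
  integral_nonneg fun _ => sq_nonneg _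

/-- CHANNEL SPLIT at the level of closed terms (law of total variance, pure algebra):
`C_N − 2 r_N² = B_N + (P_N − 2 r_N²)`. -/
theorem cumulant_split (N : ℕ) (t : ℝ) :
    powerCov ω₂ lam β γ T N t - 2 * (pairCorr ω₂ lam β γ T N t) ^ 2 =
      varianceChannel ω₂ lam β γ T N t +
        (commonPast ω₂ lam β γ T N t - 2 * (pairCorr ω₂ lam β γ T N t) ^ 2) := by
  simp only [varianceChannel]
  ring

/-- `powerCov − 2·pairCorr²` IS the integrand of the crux `PhononMeanFreePath.IncoherentChannel` as printed
in the route file (definitional unfolding of `powerCov`, `pairCorr`, `fcast`). -/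
theorem cruxIntegrand_eq (N : ℕ) (t : ℝ) :
    powerCov ω₂ lam β γ T N t - 2 * (pairCorr ω₂ lam β γ T N t) ^ 2 =
      ((∫ z, (z.2 0) ^ 2 * (∫ y, (y.2 (Fin.last N)) ^ 2
          ∂((pinnedChain ω₂ lam β γ).transitionKernel (N + 1) T T t.toNNReal z))
          ∂((pinnedChain ω₂ lam β γ).gibbsMeasure (N + 1) T)) -
        (∫ z, (z.2 0) ^ 2 ∂((pinnedChain ω₂ lam β γ).gibbsMeasure (N + 1) T)) *
          (∫ z, (∫ y, (y.2 (Fin.last N)) ^ 2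
            ∂((pinnedChain ω₂ lam β γ).transitionKernel (N + 1) T T t.toNNReal z))
            ∂((pinnedChain ω₂ lam β γ).gibbsMeasure (N + 1) T)) -
        2 * (∫ z, z.2 0 * (∫ y, y.2 (Fin.last N)
          ∂((pinnedChain ω₂ lam β γ).transitionKernel (N + 1) T T t.toNNReal z))
          ∂((pinnedChain ω₂ lam β γ).gibbsMeasure (N + 1) T)) ^ 2) := by
  simp only [powerCov, pairCorr, fcast]

/-! ## Vocabulary of the lines of crux `CoherentDephasing` (stmt-AtomisticToContinuum-11810): the coherent response field

Objects posited by line `Sketch` (idea card `coherent-field-beer-lambert`,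
`Cruxes/CoherentDephasing/Ideas/coherent-field-beer-lambert.md`) of the crux `PhononMeanFreePath.CoherentDephasing`,
appended by its line lead. The crux is about `r_N = pairCorr … N` above; the line studies the whole LINEAR RESPONSE
FIELD of the kick at `p₀` under the same Gibbs law `μ₀` and constructed kernels `K_t`:

* `kickResp … N g t = ∫ p₀ · (K_t g) dμ₀` — the Gibbs- and noise-averaged response of an observable `g` of the
  `(N+1)`-site chain at time `t` to a kick on `p₀` (`T ×` the classical fluctuation–dissipation response);
  `kickResp … (p_N) = pairCorr` (`kickResp_momentum_last_eq_pairCorr`, `rfl`);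
* coordinate instances `momResp` (`m_x = ⟨p₀, K_t p_x⟩`), `posResp` (`n_x = ⟨p₀, K_t q_x⟩`), `cubeResp`
  (`c_x = ⟨p₀, K_t q_x³⟩`), and for a bond `b = (b, b+1)` (`b : Fin N`, sites `b.castSucc`, `b.succ` of `Fin (N+1)`):
  `stretchCubeResp` (`d_b = ⟨p₀, K_t (q_{b+1} - q_b)³⟩`), `bondForceResp` (`F_b = ⟨p₀, K_t V'(q_{b+1} - q_b)⟩`,
  `V'(r) = r + β r³` for `pinnedChain`);
* `cohFlux … N b = -∫₀^∞ m_{b+1}(t) F_b(t) dt` — the time-integrated COHERENT ENERGY FLUX through bond `b` into the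
  part of the chain to its right (work done by the mean bond force on the mean momentum of site `b+1`);
* `absorbedWork … N b = lam Σ_{x ≥ b+1} ∫₀^∞ m_x c_x + β Σ_{b' > b} ∫₀^∞ d_{b'} (m_{b'+1} - m_{b'})` — the work
  ABSORBED from the mean field by the mean anharmonic polarisation strictly to the right of bond `b`.

By Dynkin's formula `(n_x, m_x)` solves exactly the free-end pinned HARMONIC chain driven by `-lam c_x + β (d_x - d_{x-1})`
and damped only at the two bath momenta, `m_x(0) = T δ_{x0}`; book-keeping its harmonic energy to the right of bond `b`
gives the fixed-`N` identity `cohFlux b = γ ∫₀^∞ m_N² + absorbedWork b` (the line's right energy balance), and the crux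
functional is `∫₀^∞ r_N² = ∫₀^∞ m_N²` (`coherentDephasing_iff_momResp`). Time integrals over `Set.Ioi 0` are Bochner
integrals (junk `0` when not integrable; at fixed `N` every integrand here decays exponentially,
`PhononMeanFreePathCoherentDephasingWeakCouplingCorrelationDecay`). Only abbreviations of tree objects and `rfl`-level
read-backs; no statement of the route is restated. -/

section CoherentField

open Set

variable (N : ℕ)

/-- **The kick response** `kickResp … N g t = ∫ p₀(z) · (∫ g dK_t(z, ·)) dμ₀(z)` of an observable `g` of the
`(N+1)`-site chain `pinnedChain ω₂ lam β γ` with both baths at `T`: the Gibbs- and noise-averaged correlation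
`⟨p₀(0) g(t)⟩`, i.e. `T ×` the mean linear response of `g` at time `t` to a unit kick on `p₀` (classical
fluctuation–dissipation). Time enters through `t.toNNReal` (constant on `t ≤ 0`, where `K_0 = id`). [folklore] -/
def kickResp (g : PhaseSpace (N + 1) → ℝ) (t : ℝ) : ℝ :=
  ∫ z, z.2 0 * (∫ y, g y ∂((pinnedChain ω₂ lam β γ).transitionKernel (N + 1) T T t.toNNReal z))
    ∂((pinnedChain ω₂ lam β γ).gibbsMeasure (N + 1) T)

/-- `m_x(t) = ⟨p₀, K_t p_x⟩_{μ₀}`: the momentum component of the coherent response field at site `x`. [folklore] -/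
def momResp (x : Fin (N + 1)) (t : ℝ) : ℝ :=
  kickResp ω₂ lam β γ T N (fun y => y.2 x) t

/-- `n_x(t) = ⟨p₀, K_t q_x⟩_{μ₀}`: the position component of the coherent response field at site `x`. [folklore] -/
def posResp (x : Fin (N + 1)) (t : ℝ) : ℝ :=
  kickResp ω₂ lam β γ T N (fun y => y.1 x) t

/-- `c_x(t) = ⟨p₀, K_t q_x³⟩_{μ₀}`: the response of the on-site cubic polarisation at site `x` (the anharmonic
pinning force of `pinnedChain` is `-lam q_x³`). [folklore] -/
def cubeResp (x : Fin (N + 1)) (t : ℝ) : ℝ :=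
  kickResp ω₂ lam β γ T N (fun y => y.1 x ^ 3) t

/-- `d_b(t) = ⟨p₀, K_t (q_{b+1} - q_b)³⟩_{μ₀}`: the response of the cubic polarisation of bond `b = (b, b+1)`
(sites `b.castSucc`, `b.succ` of `Fin (N+1)`; the anharmonic part of the bond force is `β (q_{b+1} - q_b)³`).
[folklore] -/
def stretchCubeResp (b : Fin N) (t : ℝ) : ℝ :=
  kickResp ω₂ lam β γ T N (fun y => (y.1 b.succ - y.1 b.castSucc) ^ 3) t

/-- `F_b(t) = ⟨p₀, K_t V'(q_{b+1} - q_b)⟩_{μ₀}` with `V'(r) = r + β r³`: the response of the full force of bond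
`b = (b, b+1)` (it acts with `+` on site `b` and with `-` on site `b+1`). [folklore] -/
def bondForceResp (b : Fin N) (t : ℝ) : ℝ :=
  kickResp ω₂ lam β γ T N
    (fun y => (y.1 b.succ - y.1 b.castSucc) + β * (y.1 b.succ - y.1 b.castSucc) ^ 3) t

/-- **The coherent energy flux** through bond `b = (b, b+1)` into the part of the chain to its right, integrated
over all times: `cohFlux … N b = -∫₀^∞ m_{b+1}(t) · F_b(t) dt` (the work done by the mean bond force on the mean
momentum of site `b+1`). [folklore] -/
def cohFlux (b : Fin N) : ℝ :=
  -∫ t in Ioi (0 : ℝ), momResp ω₂ lam β γ T N b.succ t * bondForceResp ω₂ lam β γ T N b t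

/-- **The work absorbed from the coherent field strictly to the right of bond `b`** by the mean anharmonic
polarisation: `absorbedWork … N b = lam Σ_{x ≥ b+1} ∫₀^∞ m_x c_x dt + β Σ_{b' > b} ∫₀^∞ d_{b'} (m_{b'+1} - m_{b'}) dt`
(sites `x : Fin (N+1)` with `b.succ ≤ x`, bonds `b' : Fin N` with `b < b'`). [folklore] -/
def absorbedWork (b : Fin N) : ℝ :=
  lam * (∑ x ∈ Finset.univ.filter (fun x : Fin (N + 1) => b.succ ≤ x),
      ∫ t in Ioi (0 : ℝ), momResp ω₂ lam β γ T N x t * cubeResp ω₂ lam β γ T N x t) +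
    β * ∑ b' ∈ Finset.univ.filter (fun b' : Fin N => b < b'),
      ∫ t in Ioi (0 : ℝ), stretchCubeResp ω₂ lam β γ T N b' t *
        (momResp ω₂ lam β γ T N b'.succ t - momResp ω₂ lam β γ T N b'.castSucc t)

/-- The kick response of the last momentum IS the route's pair correlation `r_N = pairCorr … N`, by `rfl`.
[folklore] -/
theorem kickResp_momentum_last_eq_pairCorr (t : ℝ) :
    kickResp ω₂ lam β γ T N (fun y => y.2 (Fin.last N)) t = pairCorr ω₂ lam β γ T N t :=
  rfl

/-- `m_N = r_N`: the momentum response at the last site is the crux's pair correlation, by `rfl`. [folklore] -/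
theorem momResp_last_eq_pairCorr (t : ℝ) :
    momResp ω₂ lam β γ T N (Fin.last N) t = pairCorr ω₂ lam β γ T N t :=
  rfl

/-- `m_N(t)` written out as the crux integrand `∫ p₀ · (K_t p_N) dμ₀` (`rfl`). [folklore] -/
theorem momResp_last_eq (t : ℝ) :
    momResp ω₂ lam β γ T N (Fin.last N) t =
      ∫ z, z.2 0 * (∫ y, y.2 (Fin.last N)
        ∂((pinnedChain ω₂ lam β γ).transitionKernel (N + 1) T T t.toNNReal z))
        ∂((pinnedChain ω₂ lam β γ).gibbsMeasure (N + 1) T) :=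
  rfl

end CoherentField

/-- **The crux through the response field**: `CoherentDephasing` is, by `Iff.rfl`, the statement that for all
admissible parameters `t ↦ m_N(t)²` is integrable on `(0,∞)` for every `N` and `N ∫₀^∞ m_N² → 0`
(read-back only; not a restatement to be cited in place of the route decl). [folklore] -/
theorem coherentDephasing_iff_momResp :
    Summit.AtomisticToContinuum.FouriersLaw.Theses.PhononMeanFreePath.CoherentDephasing ↔
      ∀ ω₂ lam β γ : ℝ, 0 < ω₂ → 0 < lam → 0 < β → 0 < γ → ∀ T : ℝ, 0 < T →
        (∀ N : ℕ, IntegrableOn (fun t : ℝ => momResp ω₂ lam β γ T N (Fin.last N) t ^ 2) (Set.Ioi 0)) ∧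
          Filter.Tendsto (fun N : ℕ => (N : ℝ) * ∫ t in Set.Ioi (0 : ℝ), momResp ω₂ lam β γ T N (Fin.last N) t ^ 2)
            Filter.atTop (nhds 0) :=
  Iff.rfl

/-! ## Sitewise bookkeeping of the coherent field (crux `CoherentDephasing`, line `Sketch`, lead's reduction `LocalFGR`)

The SYMMETRIC attribution of the same energy bookkeeping (appended by the line lead for the reduction
`Theorems/PhononMeanFreePathCoherentDephasingLocalFGR.lean`): the coherent site energy
`e_x = ½(m_x² + ω₂ n_x²) + ¼((n_x - n_{x-1})² + (n_{x+1} - n_x)²)` (each harmonic bond energy shared equally by its two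
sites), the symmetric harmonic flux `j_b = -½(m_b + m_{b+1})(n_{b+1} - n_b)` (the mean-field value of the route's
`OscillatorChain.bondCurrent` for the harmonic part of `V`), and the SITE WORK
`s_x = -∫₀^∞ m_x φ_x^{anh} = lam ∫₀^∞ m_x c_x + β ∫₀^∞ m_x (d_{x-1} - d_x)` done on the mean anharmonic force at `x`
(`φ_x^{anh} = -lam c_x + β (d_x - d_{x-1})`, bond `b` pushing its left site with `+β d_b` and its right site with `-β d_b`).
Exact fixed-`N` balances (Dynkin + FTC, to be landed as stubs): `Ĵ_{x-1} - Ĵ_x = s_x` at bulk sites,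
`T²/2 = Ĵ_0 + s_0 + γ∫m_0²`, `Ĵ_{N-1} = s_N + γ∫m_N²`; and `|j_b| ≤ e_b + e_{b+1}` pointwise (AM–GM), the transport bound
of `LocalFGR`. Relation to the right attribution above: `Ĵ_b = -∫ m_{b+1}(n_{b+1} - n_b)` (since
`∫ (m_{b+1} - m_b)(n_{b+1} - n_b) = [½(n_{b+1} - n_b)²]₀^∞ = 0`), so `cohFlux b = Ĵ_b - β ∫ m_{b+1} d_b`. -/

section SiteBookkeeping

open Set

variable (N : ℕ)

/-- **Coherent site energy density** `e_x(t) = ½(m_x(t)² + ω₂ n_x(t)²) + ¼ Σ_{b ∋ x} (n_{b+1}(t) - n_b(t))²` (the harmonic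
energy of the mean field at site `x`, each bond's stretch energy shared equally between its two sites; the sum runs over
the at most two bonds `b` with `b.castSucc = x` or `b.succ = x`). [folklore] -/
def cohEnergyDensity (x : Fin (N + 1)) (t : ℝ) : ℝ :=
  (momResp ω₂ lam β γ T N x t ^ 2 + ω₂ * posResp ω₂ lam β γ T N x t ^ 2) / 2 +
    (1 / 4) * ∑ b : Fin N, if (b : ℕ) = (x : ℕ) ∨ (b : ℕ) + 1 = (x : ℕ) then
      (posResp ω₂ lam β γ T N b.succ t - posResp ω₂ lam β γ T N b.castSucc t) ^ 2 else 0

/-- **Time-integrated coherent site energy** `E_x = ∫₀^∞ e_x(t) dt` (`≥ 0`). [folklore] -/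
def cohEnergy (x : Fin (N + 1)) : ℝ :=
  ∫ t in Ioi (0 : ℝ), cohEnergyDensity ω₂ lam β γ T N x t

/-- **Symmetric harmonic coherent flux** through bond `b = (b, b+1)`, integrated over all times:
`harmFlux … b = -½ ∫₀^∞ (m_b + m_{b+1})(n_{b+1} - n_b) dt` (the time-integrated mean-field value of the harmonic bond
current `-½(p_b + p_{b+1}) V'_harm(q_{b+1} - q_b)`). [folklore] -/
def harmFlux (b : Fin N) : ℝ :=
  -(1 / 2) * ∫ t in Ioi (0 : ℝ), (momResp ω₂ lam β γ T N b.castSucc t + momResp ω₂ lam β γ T N b.succ t) *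
    (posResp ω₂ lam β γ T N b.succ t - posResp ω₂ lam β γ T N b.castSucc t)

/-- **Site work** `s_x = lam ∫₀^∞ m_x c_x dt + β Σ_b ([b+1 = x] - [b = x]) ∫₀^∞ m_x d_b dt`: the work extracted from the
mean (coherent) field at site `x` by the mean anharmonic force acting on `x` (on-site cubic `-lam q_x³`; bond cubic
`β(q_{b+1} - q_b)³`, `+` on the bond's left site `b`, `-` on its right site `b+1`). The bulk site balance is
`harmFlux (x-1) - harmFlux x = siteWork x`. [folklore] -/
def siteWork (x : Fin (N + 1)) : ℝ :=
  lam * (∫ t in Ioi (0 : ℝ), momResp ω₂ lam β γ T N x t * cubeResp ω₂ lam β γ T N x t) +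
    β * ∑ b : Fin N, ((if (b : ℕ) + 1 = (x : ℕ) then (1 : ℝ) else 0) - (if (b : ℕ) = (x : ℕ) then 1 else 0)) *
      ∫ t in Ioi (0 : ℝ), momResp ω₂ lam β γ T N x t * stretchCubeResp ω₂ lam β γ T N b t

/-- The coherent site energy density is non-negative. [folklore] -/
theorem cohEnergyDensity_nonneg (hω : 0 ≤ ω₂) (x : Fin (N + 1)) (t : ℝ) :
    0 ≤ cohEnergyDensity ω₂ lam β γ T N x t := by
  unfold cohEnergyDensity
  refine add_nonneg (by positivity) (mul_nonneg (by norm_num) (Finset.sum_nonneg fun b _ => ?_))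
  split_ifs <;> positivity

/-- `E_x ≥ 0` (integral of a non-negative function; also when it is the Bochner junk value `0`). [folklore] -/
theorem cohEnergy_nonneg (hω : 0 ≤ ω₂) (x : Fin (N + 1)) : 0 ≤ cohEnergy ω₂ lam β γ T N x :=
  setIntegral_nonneg measurableSet_Ioi fun t _ => cohEnergyDensity_nonneg ω₂ lam β γ T N hω x t

end SiteBookkeeping

end Summit.AtomisticToContinuum.FouriersLaw.Theorems.PhononMeanFreePath

end
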